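import Summits.NavierStokesRegularity.NavierStokesRegularity.Theses.HalfHolderEnergy
import Summits.NavierStokesRegularity.NavierStokesRegularity.Theorems.StretchingWellBindingEnstrophyQuarterLawSmoothingEnvelope
import Summits.NavierStokesRegularity.NavierStokesRegularity.Theorems.StretchingWellBindingEnstrophyQuarterLawFarFieldEnstrophy
import Summits.NavierStokesRegularity.NavierStokesRegularity.Theorems.StretchingWellBindingEnstrophyQuarterLawSieve
import HarnessLib.Audit

/-!
# Line «sparse_sieve» for the crux `HalfHolderEnergy.EnergyHalfHolder` (stmt-NavierStokesRegularity-25161)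

LEVER (answers idea-crit-8 VERDICT 6 P1 / VERDICT on LINE 2 P3: "which NS structure bounds
dissipation per short window?"): **ε-regularity run as a dyadic sieve.** The NS structure is the
Caffarelli–Kohn–Nirenberg / Barker–Prange–Kang–Miura–Tsai *localized smoothing* theorem: a ball
on which the critical norm `‖u(t₀)‖_{L³(B_{2R}(x₀))}` is below a universal `γ` (plus a scale-`R`
local energy bound) is smooth on `B_{R/4}(x₀) × [t₀ + σR²/4, t₀ + σR²]` with `|∇u| ≤ C/R²`
(`SmoothingEnvelope`, Barker–Prange 2020 Thm 1 = arXiv:1812.09115 p. 2; Kang–Miura–Tsai 2021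
Thm 1.1; the tree has its slab form as the hypothesis `hT1` of
`Literature.Analysis.FluidPDE.BarkerPrange2020_thm2_of_thm1`). Per window `[b − τ, b]` one sieves
space dyadically: at level `j` (scale `R_j = 2^j c₀√τ`, restart time `b − σR_j²`) the *bad* set is
covered by the `8R_j`-balls around a maximal separated family of `γ`-concentrating balls — at most
`N₀` of them by `UniformSparseness` — so the shell handled at level `j − 1` costs
`≲ N₀ · τ/R_{j−1}` of dissipation, a geometric series summing to `O(N₀ √τ)`; the innermost core
(`N₀` balls of radius `8c₀√τ`) costs `≤ N₀ · M · 8c₀√τ` by the uniform local Type-I bound on the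
scaled dissipation `E(z, r) ≤ M` (`UniformLocalTypeI`); the far field costs `O(τ)` (Tao 2011
Thm 10.1 exterior form, tree fact `NS.tao2011_enstrophyLocalisation_exterior`); early windows
(`b ≤ T/2`) cost `O(τ)` by the proved early-slab bound
(`Cruxes/EnstrophyQuarterLaw/Lines/birth.lean: earlySlab_enstrophy_bound`). Hence the window law
`∫_a^b ∫ |curl u|² ≤ K √(b − a)` = `EnergyHalfHolder` — with NO finiteness of the singular set, NO
pointwise blow-up envelope, NO Liouville theorem and NO backward uniqueness.

What stays OPEN is typed as two velocity-side hypotheses on the top slab, both holding on every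
Type-I / discretely-self-similar blow-up scenario and neither known to imply regularity:
`UniformLocalTypeI` (CKN quantities `A`, `E` uniformly bounded — Seregin's `G < ∞` world) and
`UniformSparseness` (at every time and every scale `≤ r₀` at most `N₀` disjoint balls carry
`L³`-mass `≥ ε₀` — "no satellite swarms"; NOT implied by `sup`-rate Type I + energy, where the
count of `ε₀`-balls at the parabolic scale may grow like `E₀/(ε₀³ √(T−t))`, which is exactly the
log-divergence the sieve must exclude). HONEST PLACEMENT: on the route `HalfHolderEnergy` this line
is a DETOUR (there `UniformLocalTypeI ∧ NoLocalTypeISingularity` already gives `S` by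
Albritton–Barker); its value is on the SHELF 1574 (`EnstrophyQuarterLaw ⇐ EnergyHalfHolder ∧
TypeIliouvilleNoTypeII ∧ WindowToSlice`, line `window_average`): it replaces the heart stub
`stub_typeICells` of `Lines/birth.lean` (finitely many cells WITH an explicit vorticity envelope)
by sparseness WITHOUT envelope or finiteness, and it proves `EnergyHalfHolder` on the whole
uniformly-sparse Type-I stratum (the BC5 witness family of item 25161, far beyond the DSS rung).

No summit is proved by this line. `lean check`: rc 0, `sorry` exactly in the five `stub_*`.

WIRING 2026-08-28 (ns-hhe-c1 g5, statements byte-identical): stubs 3/4/5 are CLOSED BY NAME by the landed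
Theorems files of the shelf-1574 twin `Lines/sparse_sieve.lean` (`…SmoothingEnvelope` p614511,
`…FarFieldEnstrophy` p607039, `…Sieve` p612439; ns-hhe-c1 g0/g2, `--supports stmt-NavierStokesRegularity-1574`;
their signatures are these stubs with the local predicates unfolded, so they close here by `defeq`);
`sorry` now remains exactly in `stub_uniformLocalTypeI` (S1, OPEN; implied BY the window law —
`Theorems.EnstrophyQuarterLaw.LocalTypeI.uniformLocalTypeI_of_energyHalfHolder`, p619704 — but not known
from the binders alone) and `stub_uniformSparseness` (S2, OPEN). No summit is proved by this line;
`EnergyHalfHolder` (25161) stays OPEN.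
-/

set_option linter.dupNamespace false

noncomputable section

open MeasureTheory Set Metric
open scoped ENNReal

namespace Summit.NavierStokesRegularity.NavierStokesRegularity.Cruxes.EnergyHalfHolder.SparseSieve

open Literature.Analysis.FluidPDE

/-! ### The typed pieces (predicates of one solution `u` on `[0, T)`) -/

/-- **(CT) Uniform local Type I in the CKN quantities `A` and `E`** on the slab of scales `≤ r₀`:
`R⁻¹ ∫_{B_R(x)} |u(s)|² ≤ M` for all `s < T`, `x`, `0 < R ≤ r₀`, and
`R⁻¹ ∫_{b−R²}^{b} ∫_{B_R(x)} |∇u|² ≤ M` for all final times `b ≤ T`. OPEN (holds on Type-I / DSS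
strata; Seregin's `G(z₀) < ∞`, `min{…} = ∞` for Type II, Seregin 2014 notes Def. 3.5 / (3.3.15)). -/
def UniformLocalTypeI (T : ℝ) (u : ℝ → EuclideanSpace ℝ (Fin 3) → EuclideanSpace ℝ (Fin 3)) : Prop :=
  ∃ M r₀ : ℝ, 0 < M ∧ 0 < r₀ ∧
    (∀ s ∈ Set.Ico 0 T, ∀ (x : EuclideanSpace ℝ (Fin 3)), ∀ R ∈ Set.Ioc 0 r₀,
      ∫⁻ y in Metric.ball x R, ‖u s y‖ₑ ^ 2 ≤ ENNReal.ofReal (M * R)) ∧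
    (∀ b ∈ Set.Ioc 0 T, ∀ (x : EuclideanSpace ℝ (Fin 3)), ∀ R ∈ Set.Ioc 0 r₀, R ^ 2 ≤ b →
      ∫⁻ t in Set.Ioo (b - R ^ 2) b, ∫⁻ y in Metric.ball x R, ‖fderiv ℝ (u t) y‖ₑ ^ 2 ≤
        ENNReal.ofReal (M * R))

/-- **(BM) Uniform sparseness of critical concentration AT EVERY THRESHOLD** ("no satellite
swarms"; thresholds LINKED per idea-crit-8 VERDICT on LINE 3, P1⁶): there is a scale `r₀ > 0` such
that for EVERY threshold `ε₀ > 0` some `N₀ = N₀(ε₀)` bounds, at every time `t < T` and every scale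
`0 < r ≤ r₀`, the size of any `4r`-separated finite family of centres whose `2r`-balls each carry
`∫ |u(t)|³ ≥ ε₀³`. (On Type-I profile scenarios `N₀(ε₀) ~ (C/ε₀)³ + U E₀/ε₀³`.) The sieve applies it
at the threshold `ε₀ := γ` produced by `SmoothingEnvelope`. OPEN; the new currency of the line. -/
def UniformSparseness (T : ℝ) (u : ℝ → EuclideanSpace ℝ (Fin 3) → EuclideanSpace ℝ (Fin 3)) : Prop :=
  ∃ r₀ : ℝ, 0 < r₀ ∧ ∀ ε₀ : ℝ, 0 < ε₀ → ∃ N₀ : ℕ,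
    ∀ t ∈ Set.Ico 0 T, ∀ r ∈ Set.Ioc 0 r₀, ∀ F : Finset (EuclideanSpace ℝ (Fin 3)),
      (∀ x ∈ F, ∀ y ∈ F, x ≠ y → 4 * r ≤ dist x y) →
      (∀ x ∈ F, ENNReal.ofReal (ε₀ ^ 3) ≤ ∫⁻ y in Metric.ball x (2 * r), ‖u t y‖ₑ ^ 3) →
      F.card ≤ N₀

/-- **(SE) Smoothing envelope = localized smoothing, quantitative and rescaled** (Barker–Prange 2020
Thm 1 / Kang–Miura–Tsai 2021 Thm 1.1 + interior gradient bound): given a scale-`r₀` local energy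
bound with constant `M`, there are `γ, σ > 0` and `C` such that for every final time `b ≤ T`,
centre `x₀` and scale `0 < R ≤ r₀` with restart time `b − σR² ≥ 0`, smallness
`∫_{B_{2R}(x₀)} |u(b − σR²)|³ ≤ γ³` forces the thin-slab dissipation bound
`∫_{t₁}^{b} ∫_{B_{R/4}(x₀)} |∇u|² ≤ C (b − t₁)/R` for all `t₁ ∈ [b − σR²/4, b)`
(i.e. `|∇u| ≲ R⁻²` there). KNOWN MATHEMATICS, not yet in the tree (the tree's `hT1` is the
qualitative slab form). -/
def SmoothingEnvelope (T : ℝ) (u : ℝ → EuclideanSpace ℝ (Fin 3) → EuclideanSpace ℝ (Fin 3)) : Prop :=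
  ∀ M r₀ : ℝ, 0 < M → 0 < r₀ →
    (∀ s ∈ Set.Ico 0 T, ∀ (x : EuclideanSpace ℝ (Fin 3)), ∀ R ∈ Set.Ioc 0 r₀,
      ∫⁻ y in Metric.ball x R, ‖u s y‖ₑ ^ 2 ≤ ENNReal.ofReal (M * R)) →
    ∃ γ σ C : ℝ, 0 < γ ∧ 0 < σ ∧ 0 ≤ C ∧
      ∀ (b R : ℝ) (x₀ : EuclideanSpace ℝ (Fin 3)), 0 < R → R ≤ r₀ → 0 ≤ b - σ * R ^ 2 → b ≤ T →
        ∫⁻ y in Metric.ball x₀ (2 * R), ‖u (b - σ * R ^ 2) y‖ₑ ^ 3 ≤ ENNReal.ofReal (γ ^ 3) →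
        ∀ t₁ ∈ Set.Ico (b - σ * R ^ 2 / 4) b,
          ∫⁻ t in Set.Ioo t₁ b, ∫⁻ y in Metric.ball x₀ (R / 4), ‖fderiv ℝ (u t) y‖ₑ ^ 2 ≤
            ENNReal.ofReal (C * (b - t₁) / R)

/-- **(FF) Far-field enstrophy bound** on the second half of the life span: outside some ball the
enstrophy stays bounded up to `T` (Tao 2011/2013 Thm 10.1 in the exterior form of Rem. 10.6; tree
fact `NS.tao2011_enstrophyLocalisation_exterior`, to be specialised to these classes). -/
def FarFieldEnstrophy (T : ℝ) (u : ℝ → EuclideanSpace ℝ (Fin 3) → EuclideanSpace ℝ (Fin 3)) : Prop :=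
  ∃ ρ B : ℝ, 0 ≤ B ∧ ∀ t ∈ Set.Ico (T / 2) T,
    ∫⁻ x in (Metric.ball (0 : EuclideanSpace ℝ (Fin 3)) ρ)ᶜ, ‖curl (u t) x‖ₑ ^ 2 ≤ ENNReal.ofReal B

/-- The crux's conclusion for one solution: the **window quarter law** (energy `½`-Hölder). -/
def WindowLaw (T : ℝ) (u : ℝ → EuclideanSpace ℝ (Fin 3) → EuclideanSpace ℝ (Fin 3)) : Prop :=
  ∃ K : ℝ, ∀ a b : ℝ, 0 ≤ a → a ≤ b → b ≤ T →
    ∫⁻ t in Set.Ioo a b, ∫⁻ x, ‖curl (u t) x‖ₑ ^ 2 ≤ ENNReal.ofReal (K * Real.sqrt (b - a))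

/-! ### Registered stubs -/

/-- STUB 1 (OPEN, XL; Type-I-type hypothesis in CKN currency): uniform local Type I (`A`, `E`) on
the top slab at a first blow-up of a classical Leray–Hopf solution from rapidly decaying data. -/
theorem stub_uniformLocalTypeI : ∀ (ν T : ℝ), 0 < ν → 0 < T →
    ∀ (u : ℝ → EuclideanSpace ℝ (Fin 3) → EuclideanSpace ℝ (Fin 3))
      (p : ℝ → EuclideanSpace ℝ (Fin 3) → ℝ),
    IsMaximalSmoothSolution ν 0 u p T → IsLerayHopfOn T ν 0 (u 0) u →
    HasRapidSpatialDecay (u 0) → UniformLocalTypeI T u := by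
  sorry

/-- STUB 2 (OPEN, XL; the line's new currency): uniform sparseness of `L³`-concentration. -/
theorem stub_uniformSparseness : ∀ (ν T : ℝ), 0 < ν → 0 < T →
    ∀ (u : ℝ → EuclideanSpace ℝ (Fin 3) → EuclideanSpace ℝ (Fin 3))
      (p : ℝ → EuclideanSpace ℝ (Fin 3) → ℝ),
    IsMaximalSmoothSolution ν 0 u p T → IsLerayHopfOn T ν 0 (u 0) u →
    HasRapidSpatialDecay (u 0) → UniformSparseness T u := by
  sorry

/-- STUB 3 (KNOWN, XL to vendor; Barker–Prange 2020 Thm 1 = Kang–Miura–Tsai 2021 Thm 1.1, made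
quantitative, rescaled to scale `R` and viscosity `ν`, restarted from the classical slice
`u(b − σR²)` via `IsGlobalLerayHopf.exists_isLocalEnergySolutionOn_restart`-type restarting, plus the
interior gradient estimate for bounded solutions). -/
theorem stub_smoothingEnvelope : ∀ (ν T : ℝ), 0 < ν → 0 < T →
    ∀ (u : ℝ → EuclideanSpace ℝ (Fin 3) → EuclideanSpace ℝ (Fin 3))
      (p : ℝ → EuclideanSpace ℝ (Fin 3) → ℝ),
    IsMaximalSmoothSolution ν 0 u p T → IsLerayHopfOn T ν 0 (u 0) u →
    HasRapidSpatialDecay (u 0) → SmoothingEnvelope T u :=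
  -- CLOSED 2026-08-28 (p614511, ns-hhe-c1 g2): the landed theorem, predicates unfolded (defeq).
  Summit.NavierStokesRegularity.NavierStokesRegularity.Theorems.EnstrophyQuarterLaw.SparseSieve.stub_smoothingEnvelope

/-- STUB 4 (KNOWN, M; Tao 2011 Thm 10.1 / Rem. 10.6 exterior form, tree fact
`NS.tao2011_enstrophyLocalisation_exterior`, applied on `[T/2, T)` from the smooth slice `u(T/2)`
whose vorticity is square-integrable and small outside a large ball). -/
theorem stub_farFieldEnstrophy : ∀ (ν T : ℝ), 0 < ν → 0 < T →
    ∀ (u : ℝ → EuclideanSpace ℝ (Fin 3) → EuclideanSpace ℝ (Fin 3))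
      (p : ℝ → EuclideanSpace ℝ (Fin 3) → ℝ),
    IsMaximalSmoothSolution ν 0 u p T → IsLerayHopfOn T ν 0 (u 0) u →
    HasRapidSpatialDecay (u 0) → FarFieldEnstrophy T u :=
  -- CLOSED 2026-08-28 (p607039, ns-hhe-c1 g0): the landed theorem, predicate unfolded (defeq).
  Summit.NavierStokesRegularity.NavierStokesRegularity.Theorems.EnstrophyQuarterLaw.SparseSieve.stub_farFieldEnstrophy

/-- STUB 5 (the SIEVE LEMMA, provable, L; pure measure-theoretic bookkeeping + the proved
early-slab enstrophy bound + `|curl v| ≤ ‖curlCLM‖ |Dv|`): uniform local Type I + uniform sparseness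
+ smoothing envelope + far-field bound ⇒ the window quarter law. The dyadic count is spelled out
in the module docstring and in `Lines/sparse_sieve.md`. -/
theorem stub_sieve : ∀ (ν T : ℝ), 0 < ν → 0 < T →
    ∀ (u : ℝ → EuclideanSpace ℝ (Fin 3) → EuclideanSpace ℝ (Fin 3))
      (p : ℝ → EuclideanSpace ℝ (Fin 3) → ℝ),
    IsMaximalSmoothSolution ν 0 u p T → IsLerayHopfOn T ν 0 (u 0) u →
    HasRapidSpatialDecay (u 0) →
    UniformLocalTypeI T u → UniformSparseness T u → SmoothingEnvelope T u →
    FarFieldEnstrophy T u → WindowLaw T u :=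
  -- CLOSED 2026-08-28 (p612439, ns-hhe-c1 g2): the landed sieve lemma, predicates unfolded (defeq).
  Summit.NavierStokesRegularity.NavierStokesRegularity.Theorems.EnstrophyQuarterLaw.SparseSieve.stub_sieve

/-! ### The composition (real proof; concludes the crux BY NAME, no hypotheses) -/

/-- **Skeleton theorem.** `EnergyHalfHolder` from the five stubs, all used by name. -/
theorem EnergyHalfHolder_of : Theses.HalfHolderEnergy.EnergyHalfHolder := by
  intro ν T hν hT u p hmax hLH hdec
  exact stub_sieve ν T hν hT u p hmax hLH hdec
    (stub_uniformLocalTypeI ν T hν hT u p hmax hLH hdec)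
    (stub_uniformSparseness ν T hν hT u p hmax hLH hdec)
    (stub_smoothingEnvelope ν T hν hT u p hmax hLH hdec)
    (stub_farFieldEnstrophy ν T hν hT u p hmax hLH hdec)

end Summit.NavierStokesRegularity.NavierStokesRegularity.Cruxes.EnergyHalfHolder.SparseSieve

end
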